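import Literature.AlgebraicGeometry.Motives.GoodReductionFormalFunctionsProofs
import Mathlib.AlgebraicGeometry.Geometrically.Connected
import Mathlib.AlgebraicGeometry.Morphisms.Proper
import Mathlib.AlgebraicGeometry.Morphisms.Flat
import Mathlib.RingTheory.Artinian.Ring
import HarnessLib

/-!
# A connected proper scheme with a rational point is geometrically connected (Stacks 04KV)

Topic: `Literature/AlgebraicGeometry/Morphisms`. The Stacks Project, Tag 04KV (Varieties,
Lemma 33.7.14 in the current numbering): "Let `k` be a field. Let `X` be a scheme over `k`.
Assume `X` is connected and has a `k`-rational point. Then `X` is geometrically connected."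
The printed proof uses the universal openness of `Spec k' → Spec k` (Tag 0383). This file
PROVES the statement for `X → Spec k` universally closed and quasi-separated (the case of a
fibre of a proper morphism, the only one needed downstream), by a different, purely
ring-theoretic argument on `Λ = Γ(X, 𝒪_X)`:

* `eq_zero_or_one_of_isIdempotentElem` — on a connected scheme an idempotent global function is
  `0` or `1` (its non-vanishing locus is open and closed);
* `isUnit_or_isNilpotent_of_isIntegral` — in an algebra over a field all of whose idempotents
  are trivial, an integral element is a unit or nilpotent (`k[λ]` is Artinian: the chain
  `(λⁿ)` stops, `λⁿ = λⁿ⁺¹ μ`, and `λⁿ μⁿ` is an idempotent);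
* `isNilpotent_sub_algebraMap_of_retraction` — if moreover `Λ → k` is a retraction of the
  structure map (a rational point), every integral `λ` is `c + (nilpotent)` with `c ∈ k`;
* `geometricallyConnected_of_section` — **Tag 04KV for `g : X → Spec k` universally closed,
  quasi-separated, `X` connected, with a section `s`**: `Λ` is integral over `k` (Mathlib
  `isIntegral_appTop_of_universallyClosed`), so `Λ = k ⊕ Nil(Λ)`; for a field extension `K/k`
  flat base change (Mathlib `isIso_pushoutSection_of_isQuasiSeparated_of_flat_right`) gives
  `Γ(X_K, 𝒪) = Λ ⊗_k K = K ⊕ (nil ideal)`, which has no non-trivial idempotents, so `X_K` is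
  connected (`Motives.preconnectedSpace_of_isIdempotentElem`).

Used by `Literature/AlgebraicGeometry/Resolution` (de Jong 1996, 4.11–4.12: the fibres of the
pencil fibration are geometrically connected) to pass from connected fibres with a section to
Mathlib's `GeometricallyConnected`. No named facts.

## Sources

* The Stacks Project, Tag 04KV (Varieties, Lemma 33.7.14); Tag 02KH (flat base change of
  `H⁰`). [StacksProject]
-/

noncomputable section

open CategoryTheory CategoryTheory.Limits AlgebraicGeometry TopologicalSpace Opposite
open TensorProduct

universe u

namespace Literature.AlgebraicGeometry.Morphisms

/-! ## Idempotent functions on a connected scheme -/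

/-- **On a connected scheme every idempotent global function is `0` or `1`**: the locus where
the germ of `e` is a unit is open (a basic open) and closed (its complement is the basic open of
`1 - e`, germs of `e` being `0` or `1` in the local rings), hence empty or everything, and a
section all of whose germs are `0` (resp. `1`) is `0` (resp. `1`). [folklore] -/
theorem eq_zero_or_one_of_isIdempotentElem (X : Scheme.{u}) [PreconnectedSpace X]
    (e : Γ(X, ⊤)) (he : IsIdempotentElem e) : e = 0 ∨ e = 1 := by
  -- in a local ring an idempotent is `0` or `1` (cf. `FormalBranchesSplitting.lean`)
  have hloc : ∀ {R : Type u} [CommRing R] [IsLocalRing R] {a : R}, IsIdempotentElem a →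
      a = 0 ∨ a = 1 := by
    intro R _ _ a ha
    have hmul : a * (1 - a) = 0 := by rw [mul_sub, mul_one, ha.eq, sub_self]
    rcases IsLocalRing.isUnit_or_isUnit_one_sub_self a with hu | hu
    · right
      have : (1 - a) = 0 := by
        have := congrArg (fun t => hu.unit⁻¹.1 * t) hmul
        simpa [← mul_assoc] using this
      exact (sub_eq_zero.mp this).symm
    · left
      have := congrArg (fun t => t * hu.unit⁻¹.1) hmul
      simpa [mul_assoc] using this
  -- germs are `0` or `1`
  have hgerm : ∀ x : X, X.presheaf.germ ⊤ x trivial e = 0 ∨ X.presheaf.germ ⊤ x trivial e = 1 :=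
    fun x => hloc (he.map (X.presheaf.germ ⊤ x trivial).hom)
  -- the unit locus `U` and its complement `V`
  set U : X.Opens := X.basicOpen e with hU
  set V : X.Opens := X.basicOpen (1 - e) with hV
  have hUV : (U : Set X)ᶜ = (V : Set X) := by
    ext x
    simp only [Set.mem_compl_iff, SetLike.mem_coe, hU, hV, Scheme.mem_basicOpen_top, map_sub,
      map_one]
    rcases hgerm x with h0 | h1
    · rw [h0, sub_zero]
      exact ⟨fun _ => isUnit_one, fun _ => not_isUnit_zero⟩
    · rw [h1, sub_self]
      exact ⟨fun h => (h isUnit_one).elim, fun h => (not_isUnit_zero h).elim⟩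
  have hclopen : IsClopen (U : Set X) := by
    refine ⟨?_, U.isOpen⟩
    rw [← isOpen_compl_iff, hUV]
    exact V.isOpen
  rcases isClopen_iff.mp hclopen with h0 | h1
  · -- no germ is a unit: all germs vanish
    left
    apply TopCat.Presheaf.section_ext X.sheaf ⊤ e 0
    intro x hx
    rw [map_zero]
    rcases hgerm x with h | h
    · exact h
    · exfalso
      have hxU : x ∈ (U : Set X) := by
        rw [SetLike.mem_coe, hU, Scheme.mem_basicOpen_top, h]
        exact isUnit_one
      rw [h0] at hxU
      exact hxU
  · -- every germ is a unit, hence `1`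
    right
    apply TopCat.Presheaf.section_ext X.sheaf ⊤ e 1
    intro x hx
    rw [map_one]
    rcases hgerm x with h | h
    · exfalso
      have hxU : x ∈ (U : Set X) := by rw [h1]; trivial
      rw [SetLike.mem_coe, hU, Scheme.mem_basicOpen_top, h] at hxU
      exact not_isUnit_zero hxU
    · exact h

/-! ## Integral elements of an algebra without idempotents over a field -/

section Algebra

variable {k : Type*} [Field k] {Λ : Type*} [CommRing Λ] [Algebra k Λ]

/-- **In an algebra over a field all of whose idempotents are `0` or `1`, an integral element is
a unit or nilpotent.** The subalgebra `k[λ]` is a finite-dimensional, hence Artinian, ring, so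
`λⁿ = λⁿ⁺¹ μ` for some `n`, `μ`; then `e = λⁿ μⁿ` is an idempotent: `e = 1` makes `λ` a unit and
`e = 0` makes `λⁿ = λⁿ e = 0`. [folklore] -/
theorem isUnit_or_isNilpotent_of_isIntegral
    (hid : ∀ e : Λ, IsIdempotentElem e → e = 0 ∨ e = 1) {a : Λ} (ha : IsIntegral k a) :
    IsUnit a ∨ IsNilpotent a := by
  let B := Algebra.adjoin k {a}
  let b : B := ⟨a, Algebra.self_mem_adjoin_singleton k a⟩
  haveI : Module.Finite k B := Algebra.finite_adjoin_simple_of_isIntegral ha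
  haveI : IsArtinianRing B := isArtinian_of_tower k inferInstance
  obtain ⟨n, y, hy⟩ := IsArtinian.exists_pow_succ_smul_dvd b (1 : B)
  simp only [smul_eq_mul, mul_one] at hy
  -- `hy : b ^ (n+1) * y = b ^ n`
  have hP : ∀ j : ℕ, b ^ n = b ^ (n + j) * y ^ j := by
    intro j
    induction j with
    | zero => simp
    | succ j ih =>
        calc b ^ n = b ^ (n + j) * y ^ j := ih
          _ = b ^ j * b ^ n * y ^ j := by rw [← pow_add, add_comm]
          _ = b ^ j * (b ^ (n + 1) * y) * y ^ j := by rw [hy]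
          _ = b ^ (n + (j + 1)) * y ^ (j + 1) := by ring
  set e : B := b ^ n * y ^ n with he
  have hidem : IsIdempotentElem e := by
    change e * e = e
    calc e * e = (b ^ (n + n) * y ^ n) * y ^ n := by rw [he]; ring
      _ = b ^ n * y ^ n := by rw [← hP n]
  have hea : (e : Λ) = 0 ∨ (e : Λ) = 1 := hid e (by
    change (e : Λ) * e = e
    rw [← Subalgebra.coe_mul, hidem.eq])
  rcases hea with h0 | h1
  · -- `e = 0`: `b ^ n = b ^ (2n) y ^ n = b ^ n * e = 0`
    right
    have hbn : b ^ n = 0 := by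
      have h0' : e = 0 := Subtype.ext h0
      calc b ^ n = b ^ (n + n) * y ^ n := hP n
        _ = b ^ n * e := by rw [he]; ring
        _ = 0 := by rw [h0', mul_zero]
    refine ⟨n, ?_⟩
    have := congrArg (fun t : B => (t : Λ)) hbn
    simpa using this
  · -- `e = 1`: `b ^ n` is a unit, and `b ^ n = b ^ n (b y)`, so `b y = 1`
    left
    have h1' : e = 1 := Subtype.ext h1
    have hunit : IsUnit (b ^ n) := IsUnit.of_mul_eq_one (y ^ n) (by rw [← he, h1'])
    have hby : b * y = 1 := by
      have h2 : b ^ n * (b * y) = b ^ n * 1 := by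
        rw [mul_one, ← mul_assoc, ← pow_succ, hy]
      exact hunit.mul_left_cancel h2
    have hb : IsUnit b := IsUnit.of_mul_eq_one _ hby
    exact hb.map B.val

/-- **With a retraction of the structure map, every integral element is a constant plus a
nilpotent**: if `ε : Λ → k` is a ring homomorphism with `ε ∘ (k → Λ) = id` (a rational point)
and `Λ` has only the idempotents `0`, `1`, then for integral `λ` the element `λ - ε(λ)` is
nilpotent — it is integral, killed by `ε`, hence not a unit. [folklore] -/
theorem isNilpotent_sub_algebraMap_of_retraction
    (hid : ∀ e : Λ, IsIdempotentElem e → e = 0 ∨ e = 1) (ε : Λ →+* k)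
    (hε : ∀ c : k, ε (algebraMap k Λ c) = c) {a : Λ} (ha : IsIntegral k a) :
    IsNilpotent (a - algebraMap k Λ (ε a)) := by
  have hint : IsIntegral k (a - algebraMap k Λ (ε a)) := ha.sub isIntegral_algebraMap
  rcases isUnit_or_isNilpotent_of_isIntegral hid hint with hu | hn
  · exfalso
    have h0 : ε (a - algebraMap k Λ (ε a)) = 0 := by rw [map_sub, hε, sub_self]
    have := hu.map ε
    rw [h0] at this
    exact not_isUnit_zero this
  · exact hn

end Algebra

/-! ## Idempotents after base change -/

/-- **No idempotents survive in `K ⊕ (nil)`.** Let `ψ : B → C` be an injective ring map from a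
domain `B`. If every element of `C` is of the form `ψ(b) + (nilpotent)`, then every idempotent
of `C` is `0` or `1` (an idempotent `ψ(b) + m` forces `b² - b` nilpotent, so `b ∈ {0, 1}`, and a
nilpotent idempotent vanishes). [folklore] -/
theorem eq_zero_or_one_of_forall_exists_sub_isNilpotent {B C : Type*} [CommRing B] [IsDomain B]
    [CommRing C] (ψ : B →+* C) (hψ : Function.Injective ψ)
    (hQ : ∀ c : C, ∃ b : B, IsNilpotent (c - ψ b)) (c : C) (hc : IsIdempotentElem c) :
    c = 0 ∨ c = 1 := by
  obtain ⟨b, n, hn⟩ := hQ c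
  set m := c - ψ b with hm
  have hcm : c = ψ b + m := by rw [hm]; ring
  -- `ψ (b² - b)` is nilpotent
  have hnil : IsNilpotent (ψ (b * b - b)) := by
    have e1 : ψ (b * b - b) = -(2 * ψ b * m + m * m - m) := by
      have h2 : (ψ b + m) * (ψ b + m) = ψ b + m := by rw [← hcm]; exact hc.eq
      rw [map_sub, map_mul]
      linear_combination h2
    rw [e1]
    refine IsNilpotent.neg ?_
    have hmn : IsNilpotent m := ⟨n, hn⟩
    refine Commute.isNilpotent_sub (Commute.all _ _) ?_ hmn
    refine Commute.isNilpotent_add (Commute.all _ _) ?_ ?_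
    · exact Commute.isNilpotent_mul_left (Commute.all _ _) hmn
    · exact Commute.isNilpotent_mul_left (Commute.all _ _) hmn
  -- hence `b² = b` in the domain `B`
  have hbb : b * b - b = 0 := by
    obtain ⟨N, hN⟩ := hnil
    rw [← map_pow] at hN
    have : (b * b - b) ^ N = 0 := hψ (by rw [hN, map_zero])
    exact pow_eq_zero_iff'.mp this |>.1
  have hb : b = 0 ∨ b = 1 := by
    have : b * (b - 1) = 0 := by rw [mul_sub, mul_one]; exact hbb
    rcases mul_eq_zero.mp this with h | h
    · exact Or.inl h
    · exact Or.inr (sub_eq_zero.mp h)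
  have hmnil : IsNilpotent m := ⟨n, hn⟩
  rcases hb with h0 | h1
  · -- `c = m` nilpotent and idempotent
    left
    have hcm' : c = m := by rw [hcm, h0, map_zero, zero_add]
    obtain ⟨N, hN⟩ := hmnil
    rw [← hcm'] at hN
    calc c = c ^ (N + 1) := (hc.pow_succ_eq N).symm
      _ = 0 := by rw [pow_succ, hN, zero_mul]
  · -- `1 - c = -m` nilpotent and idempotent
    right
    have h1c : IsIdempotentElem (1 - c) := hc.one_sub
    have hcm' : 1 - c = -m := by rw [hcm, h1, map_one]; ring
    obtain ⟨N, hN⟩ := hmnil.neg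
    rw [← hcm'] at hN
    have : 1 - c = 0 := by
      calc 1 - c = (1 - c) ^ (N + 1) := (h1c.pow_succ_eq N).symm
        _ = 0 := by rw [pow_succ, hN, zero_mul]
    exact (sub_eq_zero.mp this).symm

/-! ## Tag 04KV for universally closed quasi-separated schemes -/

/-- **A connected scheme, universally closed and quasi-separated over a field, with a rational
point (a section of the structure morphism) is geometrically connected** (The Stacks Project,
Tag 04KV, for such schemes). See the module docstring for the proof via
`Γ(X, 𝒪_X) = k ⊕ Nil` and flat base change. [cite: StacksProject, Tag 04KV (Varieties, Lemma 33.7.14)] -/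
theorem geometricallyConnected_of_section {k : Type u} [Field k] {T : Scheme.{u}}
    (g : T ⟶ Spec (.of k)) [UniversallyClosed g] [QuasiSeparatedSpace T] [ConnectedSpace T]
    (s : Spec (.of k) ⟶ T) (hs : s ≫ g = 𝟙 _) : GeometricallyConnected g := by
  classical
  haveI : CompactSpace T := QuasiCompact.compactSpace_of_compactSpace g
  -- `Λ = Γ(T, 𝒪)` as a `k`-algebra, its retraction `ε`, integrality
  set ek := Scheme.ΓSpecIso (.of k) with hek
  let ι : k →+* Γ(T, ⊤) := g.appTop.hom.comp ek.inv.hom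
  letI : Algebra k Γ(T, ⊤) := ι.toAlgebra
  let ε : Γ(T, ⊤) →+* k := ek.hom.hom.comp s.appTop.hom
  have hε : ∀ c : k, ε (algebraMap k Γ(T, ⊤) c) = c := by
    intro c
    change ek.hom (s.appTop (g.appTop (ek.inv c))) = c
    rw [← CommRingCat.comp_apply g.appTop, ← Scheme.Hom.comp_appTop, hs, Scheme.Hom.id_appTop]
    change (ek.inv ≫ ek.hom) c = c
    rw [Iso.inv_hom_id]
    rfl
  have hint : ∀ x : Γ(T, ⊤), IsIntegral k x := by
    intro x
    obtain ⟨p, hp, hpx⟩ := isIntegral_appTop_of_universallyClosed g x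
    refine ⟨p.map ek.hom.hom, hp.map _, ?_⟩
    rw [Polynomial.eval₂_map]
    convert hpx using 2
    ext a
    change g.appTop.hom (ek.inv (ek.hom a)) = g.appTop.hom a
    rw [Iso.hom_inv_id_apply]
  have hid : ∀ e : Γ(T, ⊤), IsIdempotentElem e → e = 0 ∨ e = 1 :=
    eq_zero_or_one_of_isIdempotentElem T
  have hdec : ∀ x : Γ(T, ⊤), IsNilpotent (x - algebraMap k Γ(T, ⊤) (ε x)) := fun x =>
    isNilpotent_sub_algebraMap_of_retraction hid ε hε (hint x)
  -- base change
  refine ⟨fun K _ y Z fst snd h ↦ ?_⟩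
  obtain ⟨φ, rfl⟩ := Spec.map_surjective y
  haveI : Flat (Spec.map φ) := by
    rw [HasRingHomProperty.Spec_iff (P := @Flat)]
    algebraize [φ.hom]
    exact inferInstanceAs (Module.Flat k K)
  -- `Z` is non-empty
  haveI : Surjective fst := MorphismProperty.of_isPullback (P := @Surjective) h.flip inferInstance
  haveI : Nonempty Z := by
    obtain ⟨z, -⟩ := fst.surjective (Classical.arbitrary T)
    exact ⟨z⟩
  -- flat base change: the square of global sections is a pushout
  have hiso := isIso_pushoutSection_of_isQuasiSeparated_of_flat_right h
    (US := ⊤) (UT := ⊤) (UX := ⊤) (UY := ⊤) le_top le_top (by simp) (isAffineOpen_top _)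
    (isAffineOpen_top _) isCompact_univ isQuasiSeparated_univ
  have sq := (isIso_pushoutSection_iff h (US := ⊤) (UT := ⊤) (UX := ⊤) (UY := ⊤) le_top le_top
    (by simp)).mp hiso
  -- the rings `A = Γ(T)`, `B = Γ(Spec K)`, `C = Γ(Z)` and the maps of the square
  let eK : K ≃+* Γ(Spec (CommRingCat.of K), ⊤) :=
    (Scheme.ΓSpecIso (.of K)).symm.commRingCatIsoToRingEquiv
  haveI : IsDomain Γ(Spec (CommRingCat.of K), ⊤) := MulEquiv.isDomain K eK.symm.toMulEquiv
  let α : Γ(T, ⊤) →+* Γ(Z, ⊤) := (fst.appLE ⊤ ⊤ (by simp)).hom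
  let ψ : Γ(Spec (CommRingCat.of K), ⊤) →+* Γ(Z, ⊤) := (snd.appLE ⊤ ⊤ (by simp)).hom
  let gT : Γ(Spec (CommRingCat.of k), ⊤) →+* Γ(T, ⊤) := (g.appLE ⊤ ⊤ le_top).hom
  let yT : Γ(Spec (CommRingCat.of k), ⊤) →+* Γ(Spec (CommRingCat.of K), ⊤) :=
    ((Spec.map φ).appLE ⊤ ⊤ le_top).hom
  have hsqw : ∀ r, α (gT r) = ψ (yT r) := fun r => by
    change (g.appLE ⊤ ⊤ le_top ≫ fst.appLE ⊤ ⊤ _) r =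
      ((Spec.map φ).appLE ⊤ ⊤ le_top ≫ snd.appLE ⊤ ⊤ _) r
    rw [sq.w]
  -- `ψ` is injective (`Γ(Z, 𝒪) ≠ 0`)
  haveI : Nontrivial Γ(Z, ⊤) := by
    obtain ⟨z⟩ := ‹Nonempty Z›
    exact (Z.presheaf.germ ⊤ z trivial).hom.domain_nontrivial
  have hψ : Function.Injective ψ := by
    intro b₁ b₂ hb
    obtain ⟨x₁, rfl⟩ := eK.surjective b₁
    obtain ⟨x₂, rfl⟩ := eK.surjective b₂
    congr 1
    exact (ψ.comp eK.toRingHom).injective hb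
  -- every `α a · ψ b` is `ψ b' + nilpotent`
  have happLE : g.appLE ⊤ ⊤ le_top = g.appTop := (Scheme.Hom.app_eq_appLE g).symm
  have hgT : ∀ c : k, gT (ek.inv.hom c) = algebraMap k Γ(T, ⊤) c := fun c => by
    change (g.appLE ⊤ ⊤ le_top).hom (ek.inv.hom c) = g.appTop.hom (ek.inv.hom c)
    rw [happLE]
  have hQgen : ∀ (a : Γ(T, ⊤)) (b : Γ(Spec (CommRingCat.of K), ⊤)),
      ∃ b' : Γ(Spec (CommRingCat.of K), ⊤), IsNilpotent (α a * ψ b - ψ b') := by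
    intro a b
    refine ⟨yT (ek.inv.hom (ε a)) * b, ?_⟩
    have e1 : α a * ψ b - ψ (yT (ek.inv.hom (ε a)) * b) =
        α (a - algebraMap k Γ(T, ⊤) (ε a)) * ψ b := by
      rw [map_mul, ← hsqw, hgT, map_sub, sub_mul]
    rw [e1]
    exact Commute.isNilpotent_mul_right (Commute.all _ _) ((hdec a).map α)
  -- comparison with the tensor product: every element of `Γ(Z, 𝒪)` is `ψ b + nilpotent`
  letI algA : Algebra Γ(Spec (CommRingCat.of k), ⊤) Γ(T, ⊤) := gT.toAlgebra
  letI algB : Algebra Γ(Spec (CommRingCat.of k), ⊤) Γ(Spec (CommRingCat.of K), ⊤) := yT.toAlgebra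
  have sq' : IsPushout (CommRingCat.ofHom (algebraMap Γ(Spec (CommRingCat.of k), ⊤) Γ(T, ⊤)))
      (CommRingCat.ofHom (algebraMap Γ(Spec (CommRingCat.of k), ⊤) Γ(Spec (CommRingCat.of K), ⊤)))
      (CommRingCat.ofHom α) (CommRingCat.ofHom ψ) := sq
  have P := CommRingCat.isPushout_tensorProduct Γ(Spec (CommRingCat.of k), ⊤) Γ(T, ⊤)
    Γ(Spec (CommRingCat.of K), ⊤)
  let e := P.isoIsPushout _ _ sq'
  have he_inl : ∀ a : Γ(T, ⊤), e.hom (a ⊗ₜ 1) = α a := fun a =>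
    congr($(IsPushout.inl_isoIsPushout_hom _ _ P sq').hom a)
  have he_inr : ∀ b : Γ(Spec (CommRingCat.of K), ⊤), e.hom (1 ⊗ₜ b) = ψ b := fun b =>
    congr($(IsPushout.inr_isoIsPushout_hom _ _ P sq').hom b)
  have hQ : ∀ c : Γ(Z, ⊤), ∃ b : Γ(Spec (CommRingCat.of K), ⊤), IsNilpotent (c - ψ b) := by
    intro c
    obtain ⟨t, rfl⟩ : ∃ t, e.hom t = c := ⟨e.inv c, by
      change (e.inv ≫ e.hom) c = c
      rw [Iso.inv_hom_id]; rfl⟩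
    induction t using TensorProduct.induction_on with
    | zero => exact ⟨0, by rw [map_zero, map_zero, sub_zero]; exact IsNilpotent.zero⟩
    | tmul a b =>
        obtain ⟨b', hb'⟩ := hQgen a b
        refine ⟨b', ?_⟩
        have : e.hom (a ⊗ₜ b) = α a * ψ b := by
          rw [show a ⊗ₜ[Γ(Spec (CommRingCat.of k), ⊤)] b = (a ⊗ₜ 1) * (1 ⊗ₜ b) by
            rw [Algebra.TensorProduct.tmul_mul_tmul, mul_one, one_mul], map_mul, he_inl, he_inr]
        rw [this]
        exact hb'
    | add t₁ t₂ h₁ h₂ =>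
        obtain ⟨b₁, hb₁⟩ := h₁
        obtain ⟨b₂, hb₂⟩ := h₂
        refine ⟨b₁ + b₂, ?_⟩
        have : e.hom (t₁ + t₂) - ψ (b₁ + b₂) = (e.hom t₁ - ψ b₁) + (e.hom t₂ - ψ b₂) := by
          rw [map_add, map_add]; ring
        rw [this]
        exact Commute.isNilpotent_add (Commute.all _ _) hb₁ hb₂
  -- conclude
  haveI : PreconnectedSpace Z :=
    Literature.AlgebraicGeometry.Motives.preconnectedSpace_of_isIdempotentElem Z fun c hc =>
      eq_zero_or_one_of_forall_exists_sub_isNilpotent ψ hψ hQ c hc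
  exact ⟨inferInstance⟩

end Literature.AlgebraicGeometry.Morphisms

end
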